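import Mathlib
import Literature.AlgebraicGeometry.Resolution.NearChainStep
import Literature.AlgebraicGeometry.Resolution.AdaptedChainRecursion
import Literature.AlgebraicGeometry.Resolution.FormalAxisOfNearChain
import Literature.AlgebraicGeometry.Resolution.OrderAlongFormalBranch
import Literature.AlgebraicGeometry.Resolution.PermissibleCentres
import HarnessLib

/-!
# No infinite chain of `τ = 2` near points over an isolated point of `Σ`

Topic: `Literature/AlgebraicGeometry/Resolution`. The case `τ = 2` of the termination of
Cossart–Piltant's principalization algorithm ([CoP1] = Cossart–Piltant 2008, proof of Prop. 4.4,
p. 11): "Assume that `τ(x_{σ(i₁)}) = 2` for some `i₁ ≥ 0`. By lemma 4.3 (2) and (3), we have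
`τ(x_{σ(i)}) = 2` and `Y_{σ(i)} = {x_{σ(i)}}` […] for `i ≥ i₁`. By (12), there exists a regular
(possibly formal) curve `Γ` such that `x_{σ(i)}` belongs to the strict transform of `Γ` for
`i ≥ i₁`. By standard arguments, we must have `Γ ⊆ Σ(i₁)`, so `Γ` is a formal branch of an
irreducible component of `Σ(i₁)` passing through `x(i₁)`: a contradiction, since `{x_{σ(i₁)}}` is
an isolated point of `Σ(X_{σ(i₁)})`."

PROVED here (`false_of_nearChain_tau_two`), completion-free except for the final formal axis, by
assembling: the STEP data of each step (`NearChainStep`), the ring-level recursion producing the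
corrected coordinates (`AdaptedChainRecursion`, on top of the weighted-order chain law
`WeightedOrderChainLaw` — Hironaka's `δ`-drop in expansion-free form), the formal axis
`𝔓 = (ŷ₂, ŷ₃) ⊆ 𝒪̂_{X,x}` with `J𝒪̂ ⊆ 𝔓^μ` (`FormalAxisOfNearChain`), and the G-ring transfer
`ord_𝔮(J) ≥ μ` for `𝔮 = 𝔓 ∩ 𝒪_{X,x} ≠ 𝔪` (`OrderAlongFormalBranch`), contradicting the isolation of
`x` in `Σ = {ord ≥ μ}` (no non-maximal prime `𝔮` of `𝒪_{X,x}` has `J𝒪_𝔮 ⊆ 𝔮^μ𝒪_𝔮`).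

## Sources

* V. Cossart, O. Piltant, J. Algebra 320 (2008), proof of Prop. 4.4, p. 11; Lemma 4.3. [CossartPiltant2008]
* H. Hironaka, *Characteristic polyhedra of singularities*, J. Math. Kyoto Univ. 7 (1967). [Hironaka1967]
-/

noncomputable section

open CategoryTheory CategoryTheory.Limits AlgebraicGeometry TopologicalSpace IsLocalRing MvPolynomial

namespace Literature.AlgebraicGeometry.Resolution

universe u

open Scheme.IdealSheafData

/-- Transport of `J_p ⊆ 𝔪_p^μ` along equal points. [folklore] -/
theorem stalkIdeal_le_pow_of_eq {Z : Scheme.{u}} (K : Z.IdealSheafData) {p q : Z} (h : q = p) {μ : ℕ}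
    (hle : stalkIdeal K p ≤ maximalIdeal _ ^ μ) : stalkIdeal K q ≤ maximalIdeal _ ^ μ := by
  subst h; exact hle

section Chain

variable (Xs : ℕ → Scheme.{u}) (π : ∀ n, Xs (n + 1) ⟶ Xs n) (y : ∀ n, Xs (n + 1))
  (hy : ∀ n, π (n + 1) (y (n + 1)) = y n) (J : ∀ n, (Xs n).IdealSheafData)

/-- The local rings `R_n = 𝒪_{X_n, x_n}`, `x_n = π_n(y_n)`, along the chain. [folklore] -/
abbrev chainRing (n : ℕ) : Type u := (Xs n).presheaf.stalk (π n (y n))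

/-- The maps `φ_n : R_n → R_{n+1}` (stalk map at `y_n`, then `y_n = x_{n+1}`). [folklore] -/
def chainMap (n : ℕ) : chainRing Xs π y n →+* chainRing Xs π y (n + 1) :=
  stalkMapCongr (π n) (y n) (π (n + 1) (y (n + 1))) (hy n)

/-- The ideals `I_n = (J_n)_{x_n}`. [folklore] -/
def chainIdeal (n : ℕ) : Ideal (chainRing Xs π y n) := stalkIdeal (J n) (π n (y n))

variable {Xs π y J} [∀ n, IsLocallyNoetherian (Xs n)] {μ : ℕ}
  (hcl : ∀ n, IsClosed ({π n (y n)} : Set (Xs n)))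
  (hπ : ∀ n, IsBlowup (π n) (vanishingIdeal ⟨{π n (y n)}, hcl n⟩))
  (hregb : ∀ n, IsRegularLocalRing ((Xs n).presheaf.stalk (π n (y n))))
  (hreg : ∀ n, IsRegularLocalRing ((Xs (n + 1)).presheaf.stalk (y n)))
  (hd : ∀ n, (maximalIdeal ((Xs n).presheaf.stalk (π n (y n)))).spanFinrank = 3)
  (hJ : ∀ n, J (n + 1) = controlledTransform (π n) (vanishingIdeal ⟨{π n (y n)}, hcl n⟩) (J n) μ)
  (hnear : ∀ n, IsNear (π n) (vanishingIdeal ⟨{π n (y n)}, hcl n⟩) (J n) μ (y n))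
  (hτb : ∀ n, @stalkTau _ (J n) (π n (y n)) (hregb n) μ = 2)
  (hτy : ∀ n, @stalkTau _ (J (n + 1)) (y n) (hreg n) μ = 2)

include hcl in
omit [∀ n, IsLocallyNoetherian (Xs n)] in
/-- `𝔪_{x_n}` is the stalk of the ideal of the reduced point. [folklore] -/
theorem maximalIdeal_chainRing_eq (n : ℕ) :
    maximalIdeal (chainRing Xs π y n) =
      stalkIdeal (vanishingIdeal ⟨{π n (y n)}, hcl n⟩) (π n (y n)) :=
  (stalkIdeal_vanishingIdeal_singleton (X := Xs n) (hcl n)).symm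

omit [∀ n, IsLocallyNoetherian (Xs n)] in
include hy hnear hJ in
/-- `I_{n+1} ⊆ 𝔪^μ` (the points are near). [cite: CossartPiltant2008, proof of Prop. 4.2 (a)] -/
theorem chainIdeal_succ_le_pow (n : ℕ) :
    chainIdeal Xs π y J (n + 1) ≤ maximalIdeal _ ^ μ := by
  unfold chainIdeal
  refine stalkIdeal_le_pow_of_eq (J (n + 1)) (hy n) ?_
  rw [hJ n]
  exact (le_idealOrder_iff _ (y n) μ).mp (isNear_iff.mp (hnear n)).ge

/-- The `φ_n` are local. [folklore] -/
instance isLocalHom_chainMap (n : ℕ) : IsLocalHom (chainMap Xs π y hy n) := by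
  unfold chainMap; infer_instance

include hπ hregb hd hnear hτb in
/-- Residue fields along the chain are reached from `R_0` (rational near points).
[cite: CossartPiltant2008, Lemma 4.3 (3)] -/
theorem chain_residue_surjective (n : ℕ) (t : ResidueField (chainRing Xs π y n)) :
    ∃ r : chainRing Xs π y 0, residue _ (compHom (chainMap Xs π y hy) n r) = t := by
  refine residue_compHom_surjective (chainMap Xs π y hy) (fun n => ?_) n t
  haveI := hregb n
  exact (hπ n).residue_comp_stalkMapCongr_surjective (hd n) (maximalIdeal_chainRing_eq hcl n)
    (hτb n) (hnear n) _ (hy n)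

include hπ hregb hreg hd hJ hnear hτb hτy in
set_option maxHeartbeats 800000 in
/-- **The STEP property along the chain.** [cite: CossartPiltant2008, Lemma 4.3 (3), (12)] -/
theorem chain_stepData (hμ : 1 ≤ μ) (j : Fin 3) (n : ℕ) (c : Fin 3 → chainRing Xs π y n)
    (hc : Ideal.span (Set.range c) = maximalIdeal _)
    (had : IsAdapted c (chainIdeal Xs π y J n) μ j) :
    haveI : ∀ n, IsRegularLocalRing (chainRing Xs π y n) := hregb
    Nonempty (StepData (chainMap Xs π y hy) (chainIdeal Xs π y J) μ j n c) := by
  haveI := hregb n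
  haveI := hreg n
  have hτy' : stalkTau (controlledTransform (π n) (vanishingIdeal ⟨{π n (y n)}, hcl n⟩) (J n) μ)
      (y n) μ = 2 := by
    rw [← hJ n]; exact hτy n
  have hS := (hπ n).exists_stepData_of_adapted_congr hμ (hd n) hc
    (hc.trans (maximalIdeal_chainRing_eq hcl n)) (hτb n) (hnear n) hτy' j had
    (π (n + 1) (y (n + 1))) (hy n)
  obtain ⟨_, c', lam, h1, -, h3, h4, h5, h6, -⟩ := hS
  refine ⟨⟨c', h1, h3, h4, fun g hg => ?_, lam, fun a ha => ?_⟩⟩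
  · change g ∈ stalkIdeal (J (n + 1)) (π (n + 1) (y (n + 1)))
    rw [hJ n]; exact h5 g hg
  · change IsAdapted (shiftRsop c' j a) (stalkIdeal (J (n + 1)) (π (n + 1) (y (n + 1)))) μ j
    rw [hJ n]; exact h6 a ha

end Chain

set_option maxHeartbeats 800000 in
/-- **[CoP1] Prop. 4.4, termination in the case `τ = 2`: there is no infinite chain of near
points with `τ = 2` over an isolated point of `Σ`.** Data: schemes `X_n` (locally Noetherian),
blowings up `π_n : X_{n+1} → X_n` of the reduced closed points `x_n := π_n(y_n)`, points
`y_n ∈ X_{n+1}` with `π_{n+1}(y_{n+1}) = y_n`, ideal sheaves `J_{n+1} = ` controlled transform of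
`J_n` with control `μ ≥ 1`; hypotheses: regular local rings of embedding dimension `3` at the
`x_n`, regular local rings at the `y_n`, every `y_n` near with `τ(x_n) = τ(y_n) = 2`,
`ord_{x_0} J_0 ≥ μ`, `𝒪_{X_0,x_0}` a G-ring, and `x_0` isolated in `Σ_0` (no non-maximal prime
`𝔮 ⊂ 𝒪_{X_0,x_0}` with `J_0 𝒪_𝔮 ⊆ (𝔮𝒪_𝔮)^μ`). Conclusion: `False`.
[cite: CossartPiltant2008, proof of Prop. 4.4, p. 11] -/
theorem false_of_nearChain_tau_two (Xs : ℕ → Scheme.{u}) [∀ n, IsLocallyNoetherian (Xs n)]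
    (π : ∀ n, Xs (n + 1) ⟶ Xs n) (y : ∀ n, Xs (n + 1)) (J : ∀ n, (Xs n).IdealSheafData) {μ : ℕ}
    (hμ : 1 ≤ μ) (hy : ∀ n, π (n + 1) (y (n + 1)) = y n)
    (hcl : ∀ n, IsClosed ({π n (y n)} : Set (Xs n)))
    (hπ : ∀ n, IsBlowup (π n) (vanishingIdeal ⟨{π n (y n)}, hcl n⟩))
    (hregb : ∀ n, IsRegularLocalRing ((Xs n).presheaf.stalk (π n (y n))))
    (hreg : ∀ n, IsRegularLocalRing ((Xs (n + 1)).presheaf.stalk (y n)))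
    (hd : ∀ n, (maximalIdeal ((Xs n).presheaf.stalk (π n (y n)))).spanFinrank = 3)
    (hJ : ∀ n, J (n + 1) = controlledTransform (π n) (vanishingIdeal ⟨{π n (y n)}, hcl n⟩) (J n) μ)
    (hnear : ∀ n, IsNear (π n) (vanishingIdeal ⟨{π n (y n)}, hcl n⟩) (J n) μ (y n))
    (hτb : ∀ n, @stalkTau _ (J n) (π n (y n)) (hregb n) μ = 2)
    (hτy : ∀ n, @stalkTau _ (J (n + 1)) (y n) (hreg n) μ = 2)
    (hord0 : stalkIdeal (J 0) (π 0 (y 0)) ≤ maximalIdeal _ ^ μ)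
    (hG : IsGRing ((Xs 0).presheaf.stalk (π 0 (y 0))))
    (hisol : ∀ (𝔮 : Ideal ((Xs 0).presheaf.stalk (π 0 (y 0)))) [𝔮.IsPrime], 𝔮 ≠ maximalIdeal _ →
      ¬ (stalkIdeal (J 0) (π 0 (y 0))).map (algebraMap _ (Localization.AtPrime 𝔮)) ≤
        maximalIdeal (Localization.AtPrime 𝔮) ^ μ) :
    False := by
  classical
  haveI : ∀ n, IsRegularLocalRing (chainRing Xs π y n) := hregb
  set R := chainRing Xs π y 0
  set φ := chainMap Xs π y hy
  set I := chainIdeal Xs π y J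
  -- `I_n ⊆ 𝔪^μ`
  have hIμ : ∀ n, I n ≤ maximalIdeal _ ^ μ := by
    intro n
    cases n with
    | zero => exact hord0
    | succ n => exact chainIdeal_succ_le_pow hy hcl hJ hnear n
  -- an adapted system at level `0`
  obtain ⟨c, hc⟩ : ∃ c : Fin 3 → R, Ideal.span (Set.range c) = maximalIdeal _ := by
    obtain ⟨c, hc⟩ := exists_regularSystemOfParameters (R := R)
    refine ⟨c ∘ finCongr (hd 0).symm, ?_⟩
    rw [(finCongr (hd 0).symm).surjective.range_comp]
    exact hc
  have hW : invarianceSpace (ResidueField R)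
      (initialForms c (I 0) μ : Set (MvPolynomial (Fin 3) (ResidueField R))) ≠ ⊥ := by
    intro hbot
    have h1 := hironakaTau_add_finrank_invarianceSpace (ResidueField R)
      (initialForms c (I 0) μ : Set (MvPolynomial (Fin 3) (ResidueField R)))
    rw [hbot, finrank_bot, add_zero] at h1
    have h2 : hironakaTauAt c (I 0) μ = 2 := by
      have := stalkTau_eq (J 0) (π 0 (y 0)) μ (hd 0) c hc
      rw [hτb 0] at this
      exact this.symm
    rw [hironakaTauAt] at h2
    omega
  obtain ⟨j, a₀, had₀⟩ := exists_isAdapted_of_ne_bot (hd 0) hc hW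
  have hc₀ : Ideal.span (Set.range (shiftRsop c j a₀)) = maximalIdeal _ := by
    rw [span_range_shiftRsop, hc]
  -- two indices different from `j`
  obtain ⟨i₁, i₂, h₁, h₂, h₁₂⟩ : ∃ i₁ i₂ : Fin 3, i₁ ≠ j ∧ i₂ ≠ j ∧ i₁ ≠ i₂ := by
    refine ⟨(finSuccAboveEquiv j 0).1, (finSuccAboveEquiv j 1).1, (finSuccAboveEquiv j 0).2,
      (finSuccAboveEquiv j 1).2, fun h => ?_⟩
    have := (finSuccAboveEquiv j).injective (Subtype.ext h)
    exact absurd this (by decide)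
  -- the corrected coordinates along the chain
  obtain ⟨z, hz0, hzj, hzd, hzI⟩ := exists_corrected_coordinates φ I μ j hd
    (chain_stepData hy hcl hπ hregb hreg hd hJ hnear hτb hτy hμ j)
    (chain_residue_surjective hy hcl hπ hregb hd hnear hτb) hIμ hc₀ had₀ h₁ h₂ h₁₂
  -- the formal axis
  have hgen : Ideal.span {shiftRsop c j a₀ j, shiftRsop c j a₀ i₁, shiftRsop c j a₀ i₂} =
      maximalIdeal R := by
    rw [insert_pair_eq_range j (shiftRsop c j a₀) h₁ h₂ h₁₂, hc₀]
  have hdim : ringKrullDim R = 3 := by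
    have := (isRegularLocalRing_iff R).mp inferInstance
    rw [hd 0] at this
    exact_mod_cast this.symm
  obtain ⟨𝔓, h𝔓prime, h𝔓ne, h𝔓le⟩ := exists_prime_ne_maximalIdeal_map_le_pow
    (shiftRsop c j a₀ j) (shiftRsop c j a₀ i₁) (shiftRsop c j a₀ i₂) hgen hdim
    (fun N => z N i₁) (fun N => z N i₂) (fun N => hzd N i₁) (fun N => hzd N i₂)
    (by rw [hz0]) (by rw [hz0]) (I 0) μ
    (fun N => by
      have h := hzI N
      have e : shiftRsop c j a₀ j = z N j := (hzj N).symm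
      simpa only [e] using h)
  -- the algebraic branch below `𝔓` lies in `Σ`: contradiction with the isolation of `x_0`
  haveI := h𝔓prime
  have hle := map_le_pow_maximalIdeal_localization_under hG (I 0) μ 𝔓 h𝔓le
  refine hisol (𝔓.under R) ?_ hle
  intro h𝔮
  apply h𝔓ne
  refine ((maximalIdeal.isMaximal _).eq_of_le h𝔓prime.ne_top ?_).symm
  rw [AdicCompletion.maximalIdeal_eq_map, Ideal.map_le_iff_le_comap]
  intro r hr
  change r ∈ 𝔓.under R
  rw [h𝔮]
  exact hr

end Literature.AlgebraicGeometry.Resolution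

end
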